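import Summits.NavierStokesRegularity.NavierStokesRegularity.Theorems.RecurrentProfilesRecurrentLiouvilleSmGenericReduction
import Summits.NavierStokesRegularity.NavierStokesRegularity.Theorems.RecurrentLiouville.Negative.KillCriterion
import HarnessLib

/-!
# Crux `RecurrentLiouville` (stmt-NavierStokesRegularity-1589), line `Sketch` v10 — stub SM5:
# the STATISTICAL CERTIFICATE of the generic recurrent reduction

`stub_smCertificate` (lead c12; registered stub of the skeleton), two clauses, both immediate from
SM4 `stub_smGenericReduction` (`Theorems/RecurrentProfilesRecurrentLiouvilleSmGenericReduction.lean`):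

* (i) **generic recurrent Liouville ⟺ crux.**  The crux `RecurrentLiouville` is EQUIVALENT to its
  restriction to GENERIC uniformly recurrent class members — those all of whose `L³_loc` statistics
  `(1/N) ∑_{k<N} Ψ (u_{e^{-k}})` along the backward log-scales exist (every bounded functional `Ψ`
  of fields continuous for an `L³(Q(0, n+1))`-seminorm).  Genericity, like recurrence itself
  (Disproof §A3, `recurrentLiouville_false_iff_typeISingularProfileExists`), is a free
  normalisation of the would-be counterexample, not a restriction of the theorem.
* (ii) **statistical kill criterion.**  A Type-I singularity model of the Albritton–Barker class
  (`RecurrentLiouville.Negative.TypeISingularProfileExists`, p116351) exists iff a uniformly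
  recurrent GENERIC one exists — the orbit form of "`¬crux` ⟺ a Type-I stationary statistical
  solution of Leray's similarity equations exists" (the crux docstring's tool (b)).

## References

* D. Albritton, T. Barker, J. Math. Fluid Mech. 21 (2019), no. 43 = arXiv:1811.00502, Thm. 1.1,
  Lemma 2.2, Prop. 2.3. [AlbrittonBarker2019]
* M. Einsiedler, T. Ward, *Functional Analysis, Spectral Theory, and Applications*, GTM 276
  (2017), Prop. 8.36, Thm. 8.80. [EinsiedlerWard2017]
-/

noncomputable section

-- the sub-problem namespace repeats the summit name (D-0017 layout `Summit.<S>.<P>.Theorems`)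
set_option linter.dupNamespace false

namespace Summit.NavierStokesRegularity.NavierStokesRegularity.Theorems

open MeasureTheory Set Function Filter Topology TopologicalSpace Metric
open Literature.Analysis Literature.Analysis.FluidPDE
open Literature.Dynamics.TopologicalDynamics
open scoped NNReal ENNReal

/-! ### The statistical certificate -/

/-- **SM5 · STATISTICAL CERTIFICATE** (registered stub of line `Sketch`, skeleton v10).  (i) The
crux is EQUIVALENT to its restriction to GENERIC uniformly recurrent class members (those all of
whose `L³_loc` statistics along the backward log-scales exist): genericity, like recurrence, is a
free normalisation bought by SM4, not a restriction.  (ii) The kill criterion in statistical form: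
a Type-I singularity model (`TypeISingularProfileExists`, p116351) exists iff a uniformly recurrent
GENERIC one exists — the orbit form of "`¬crux` ⟺ a Type-I stationary statistical solution of
Leray's similarity equations exists".  Both by SM4 `stub_smGenericReduction`.
[cite: AlbrittonBarker2019, Thm. 1.1, Prop. 2.3] -/
theorem stub_smCertificate :
    (Theses.RecurrentProfiles.RecurrentLiouville ↔
      ∀ (u : ℝ → EuclideanSpace ℝ (Fin 3) → EuclideanSpace ℝ (Fin 3))
        (p : ℝ → EuclideanSpace ℝ (Fin 3) → ℝ)
        (G : ℝ → EuclideanSpace ℝ (Fin 3) → EuclideanSpace ℝ (Fin 3) →L[ℝ] EuclideanSpace ℝ (Fin 3))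
        (C : ℝ),
        IsSuitableWeakSolutionOn (slab (EuclideanSpace ℝ (Fin 3)) (Iio 0) isOpen_Iio) 1 0 u p →
        HasWeakSpatialGradientOn (slab (EuclideanSpace ℝ (Fin 3)) (Iio 0) isOpen_Iio) u G →
        typeIBound (Iio (0 : ℝ) ×ˢ univ) u p G < ⊤ →
        HasTypeITimeDecay C u →
        IsScalingUniformlyRecurrent u →
        (∀ (n : ℕ) (Ψ : (ℝ → EuclideanSpace ℝ (Fin 3) → EuclideanSpace ℝ (Fin 3)) → ℝ),
          (∃ B : ℝ, ∀ v, |Ψ v| ≤ B) →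
          (∀ v, ∀ ε : ℝ, 0 < ε → ∃ δ : ℝ, 0 < δ ∧ ∀ v',
            eLpNorm (fun z : ℝ × EuclideanSpace ℝ (Fin 3) => v' z.1 z.2 - v z.1 z.2) 3
              (volume.restrict (parabolicCylinder ((n : ℝ) + 1)
                (0 : ℝ × EuclideanSpace ℝ (Fin 3)))) ≤ ENNReal.ofReal δ →
            |Ψ v' - Ψ v| ≤ ε) →
          ∃ c : ℝ, Tendsto (fun N : ℕ => (N : ℝ)⁻¹ *
            ∑ k ∈ Finset.range N, Ψ (nsRescale (Real.exp (-(k : ℝ))) u)) atTop (𝓝 c)) →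
        ¬ IsBackwardSingularPoint u 0) ∧
    (RecurrentLiouville.Negative.TypeISingularProfileExists ↔
      ∃ (w : ℝ → EuclideanSpace ℝ (Fin 3) → EuclideanSpace ℝ (Fin 3))
        (q : ℝ → EuclideanSpace ℝ (Fin 3) → ℝ)
        (H : ℝ → EuclideanSpace ℝ (Fin 3) → EuclideanSpace ℝ (Fin 3) →L[ℝ] EuclideanSpace ℝ (Fin 3))
        (C : ℝ),
        IsSuitableWeakSolutionOn (slab (EuclideanSpace ℝ (Fin 3)) (Iio 0) isOpen_Iio) 1 0 w q ∧
        HasWeakSpatialGradientOn (slab (EuclideanSpace ℝ (Fin 3)) (Iio 0) isOpen_Iio) w H ∧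
        typeIBound (Iio (0 : ℝ) ×ˢ univ) w q H < ⊤ ∧
        HasTypeITimeDecay C w ∧
        IsBackwardSingularPoint w 0 ∧
        IsScalingUniformlyRecurrent w ∧
        ∀ (n : ℕ) (Ψ : (ℝ → EuclideanSpace ℝ (Fin 3) → EuclideanSpace ℝ (Fin 3)) → ℝ),
          (∃ B : ℝ, ∀ v, |Ψ v| ≤ B) →
          (∀ v, ∀ ε : ℝ, 0 < ε → ∃ δ : ℝ, 0 < δ ∧ ∀ v',
            eLpNorm (fun z : ℝ × EuclideanSpace ℝ (Fin 3) => v' z.1 z.2 - v z.1 z.2) 3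
              (volume.restrict (parabolicCylinder ((n : ℝ) + 1)
                (0 : ℝ × EuclideanSpace ℝ (Fin 3)))) ≤ ENNReal.ofReal δ →
            |Ψ v' - Ψ v| ≤ ε) →
          ∃ c : ℝ, Tendsto (fun N : ℕ => (N : ℝ)⁻¹ *
            ∑ k ∈ Finset.range N, Ψ (nsRescale (Real.exp (-(k : ℝ))) w)) atTop (𝓝 c)) := by
  refine ⟨⟨fun hL u p G C hsw hwg hI hdec hrec _ => hL u p G C hsw hwg hI hdec hrec, fun hG => ?_⟩,
    ⟨?_, ?_⟩⟩
  · intro u p G C hsw hwg hI hdec _ hsing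
    obtain ⟨w, q, H, hsw', hwg', hI', hdec', hsing', hrec', hgen'⟩ :=
      stub_smGenericReduction u p G C hsw hwg hI hdec hsing
    exact hG w q H C hsw' hwg' hI' hdec' hrec' hgen' hsing'
  · rintro ⟨u, p, G, C, hsw, hwg, hI, hdec, hsing⟩
    obtain ⟨w, q, H, hsw', hwg', hI', hdec', hsing', hrec', hgen'⟩ :=
      stub_smGenericReduction u p G C hsw hwg hI hdec hsing
    exact ⟨w, q, H, C, hsw', hwg', hI', hdec', hsing', hrec', hgen'⟩
  · rintro ⟨w, q, H, C, hsw, hwg, hI, hdec, hsing, -, -⟩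
    exact ⟨w, q, H, C, hsw, hwg, hI, hdec, hsing⟩

end Summit.NavierStokesRegularity.NavierStokesRegularity.Theorems

end
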